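import Mathlib
import HarnessLib
import Literature.Analysis.FluidPDE.TypeIAncientMild
import Literature.Analysis.FluidPDE.TypeIAncientMildRescale
import Literature.Analysis.FluidPDE.AxisymmetricVorticityTransport
import Literature.Analysis.FluidPDE.HyperbolicDSSOrbit
import Literature.Analysis.FluidPDE.AncientSimilarityVariables
import Literature.Analysis.FluidPDE.AncientSimilarityVorticity
import Summits.NavierStokesRegularity.NavierStokesRegularity.Theorems.AdaptedFrequencyTangentFlowTransferAncientPressure
import Summits.NavierStokesRegularity.NavierStokesRegularity.Theorems.PoloidalWindowDoorPoloidalWindowRigidityNearIdentityDefs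

/-!
# Crux `PoloidalWindowRigidity` (stmt-19708) — LINE 32 `crystal`, ANNEX: THE BREATHER NORMAL FORM of hand H2 (PROVED, 0 sorry; class level)
# (IDEATOR seat ns-idea-8, generation 14; companion of `Lines/crystal.lean`; imports `Theorems/` + `Literature/` only)

LINE 32 proves (`Lines/crystal.lean` §45 `crystalAt_of`) that the vertical similarity group of a pinned peakless profile about a bounded centre is a
CRYSTAL `C_n × ℤ` whose infinite part, when present, is generated by ONE coarse rotation-twisted scaling `g₀ = (θ₀, e^{ℓ₀})`, `ℓ₀ ≥ ρ′(C,B) > 0`; its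
open hand is H2 `NoPinnedBreather` (no pinned peakless profile has a screw-scaling symmetry with factor `λ > 1`).  This annex records, at CLASS level
and sorry-free, what such a symmetry IS in the backward similarity (Leray) variables of Chae–Wolf 2017 §4 / Bradshaw–Tsai 2017 §1 (the tree's
`lerayOrbit`, `IsBackwardLeraySolutionOn`, `IsRotatedDSS.lerayOrbit_add_period`): for `w` in the KNSS class `IsTypeIAncientMild C w` with
`IsScrew θ λ w`, `λ > 0`, the profile `V = lerayOrbit w`, `V(s,y) = e^{−s/2} w(−e^{−s}, e^{−s/2}y)`, is a classical solution of the autonomous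
backward Leray system `∂ₛV + ½V + ½(y·∇)V + (V·∇)V + ∇P = ΔV`, `div V = 0` on ALL of `ℝ × ℝ³`, is BOUNDED by `C` (Type-I TIME decay only — no spatial
decay is available or claimed), and is TWISTED-PERIODIC with period `S = 2 log λ`: `V(s + S, y) = R_{−θ} V(s, R_θ y)` (`breather_normal_form`; centred
version `breather_normal_form_about`).  So H2 reads: «no bounded, e₂-poloidal, pinned solution of the backward Leray system on `ℝ × ℝ³` is periodic modulo a
vertical rotation» — Pineau–Vicol's RDSS object (arXiv:2607.09619, (1.13)–(1.14): «the profile U is a time-periodic solution of [the Leray system in a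
rotating frame]», Remark 1.8: the Navier–Stokes BREATHERS), in the decay-free pinned class, at ALL periods `S ≥ 2ρ′`.  Their Thm 1.7 treats `|α| + S ≪ 1`
or `α ≫ 1, λ ≈ 1` WITH decay (1.10); LINES 28–30 the near-identity range without decay; the coarse range is OPEN everywhere (backward DSS Liouville).
WHY THIS HELPS (the transfer, honestly): the unknown of H2 is now a PERIODIC ORBIT of the Leray semiflow — a compact object in `s` — so time-averaged
identities over one period, periodic-parabolic maximum principles and Floquet-type arguments apply to it, none of which make sense for a general
critical element of the cells; it does NOT by itself supply the missing coercivity (PV p.4: no α-modified head pressure is known).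
Tree placement (dedup, `rg` 16:0xZ): `QuantisedSymmetry…ExistsStubLerayOrbitOfRepresentative.stub_lerayOrbitOfRepresentative` is the PURE-DSS version
WITH space–time decay `HasTypeIDecay` (profile bound `(1+|y|)|U| ≤ C₀`); `PineauVicol2026.exists_isBackwardLeraySolutionOn_of_rdss` the RDSS version from
PV's hypotheses (classical on `[−1,0)`, space–time Type I, ansatz).  NEW here: rotated + TIME-decay-only, stated for the column's symmetry predicate
`IsScrew` / `IsScrewAbout` of `Theorems/…NearIdentityDefs` (the past truncation `pastOf` bridges `∀ t < 0` to Chae–Wolf's all-time `IsRotatedDSS`).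
LABELS: files-only annex; nothing closed; 19708 / 20428 OPEN; no summit is proved by any line; NS regularity NOT proved.
-/

set_option linter.dupNamespace false
set_option linter.unusedVariables false

noncomputable section

namespace Summit.NavierStokesRegularity.NavierStokesRegularity.Cruxes.PoloidalWindowRigidity.CrystalBreather

open Set Function Filter Topology
open Literature.Analysis Literature.Analysis.FluidPDE
open Summit.NavierStokesRegularity.NavierStokesRegularity.Theorems
open Summit.NavierStokesRegularity.NavierStokesRegularity.Theorems.PoloidalWindowDoorPoloidalWindowRigidityNearIdentityDefs

/-- Physical space. -/
abbrev E₃ : Type := EuclideanSpace ℝ (Fin 3)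

/-- The PAST TRUNCATION of a field: its values for `t ≥ 0` (never read by the column, whose objects live on `t < 0`) are set to `0`, so that the
column's `∀ t < 0` symmetry predicates become Chae–Wolf's all-time `IsRotatedDSS`. -/
def pastOf (w : ℝ → E₃ → E₃) : ℝ → E₃ → E₃ := fun t x => if t < 0 then w t x else 0

theorem pastOf_of_neg (w : ℝ → E₃ → E₃) {t : ℝ} (ht : t < 0) (x : E₃) : pastOf w t x = w t x := by
  simp [pastOf, ht]

/-- The Leray orbit only reads the past: `lerayOrbit (pastOf w) = lerayOrbit w`. -/
theorem lerayOrbit_pastOf (w : ℝ → E₃ → E₃) : lerayOrbit (pastOf w) = lerayOrbit w := by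
  funext s y
  have hs : -Real.exp (-s) < 0 := by have := Real.exp_pos (-s); linarith
  simp only [lerayOrbit_apply, pastOf_of_neg w hs]

/-- **Screw symmetry ⇒ rotated discrete self-similarity (Chae–Wolf 2017, Def. 1.1) of the past truncation**, factor `λ`, rotation `R_θ`. -/
theorem isRotatedDSS_pastOf {θ lam : ℝ} {w : ℝ → E₃ → E₃} (hl : 0 < lam) (hs : IsScrew θ lam w) :
    IsRotatedDSS lam (rotZLIE θ) (pastOf w) := by
  intro t x
  by_cases ht : t < 0
  · have h2 : lam ^ 2 * t < 0 := mul_neg_of_pos_of_neg (pow_pos hl 2) ht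
    rw [pastOf_of_neg w ht, pastOf_of_neg w h2, rotZLIE_symm_apply, rotZLIE_apply]
    exact (hs t ht x).symm
  · have h2 : ¬ lam ^ 2 * t < 0 := by
      intro h
      have : 0 ≤ lam ^ 2 * t := mul_nonneg (pow_pos hl 2).le (not_lt.1 ht)
      linarith
    simp only [pastOf, ht, h2, if_false, smul_eq_zero]
    exact Or.inr (rotZLIE (-θ)).map_zero

/-- `√(e^{−s}) = e^{−s/2}`. -/
theorem sqrt_exp_neg (s : ℝ) : Real.sqrt (Real.exp (-s)) = Real.exp (-s / 2) := by
  have h : Real.exp (-s) = Real.exp (-s / 2) ^ 2 := by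
    rw [sq, ← Real.exp_add]; ring_nf
  rw [h, Real.sqrt_sq (Real.exp_pos _).le]

/-- **THE BREATHER NORMAL FORM (PROVED, class level).**  A vertical screw-scaling symmetry `IsScrew θ λ w` (`λ > 0`) of a field of the KNSS class
`IsTypeIAncientMild C w` makes its backward similarity profile `V = lerayOrbit w` a classical solution of the backward Leray system on all of `ℝ × ℝ³`
(with the pressure `lerayOrbitPressure q` of a KNSS pressure `q`), BOUNDED by `C`, and TWISTED-PERIODIC: `V(s + 2 log λ, y) = R_{−θ} V(s, R_θ y)`.
For `λ > 1` this is a rotation-twisted time-PERIODIC orbit of period `S = 2 log λ > 0` — Pineau–Vicol's RDSS profile / Navier–Stokes breather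
(arXiv:2607.09619 (1.13)–(1.14), Remark 1.8), WITHOUT their decay hypothesis (1.10). -/
theorem breather_normal_form {C θ lam : ℝ} {w : ℝ → E₃ → E₃} (hw : IsTypeIAncientMild C w) (hl : 0 < lam)
    (hs : IsScrew θ lam w) :
    ∃ P : ℝ → E₃ → ℝ,
      IsBackwardLeraySolutionOn univ 1 (lerayOrbit w) P ∧
      (∀ (s : ℝ) (y : E₃), ‖lerayOrbit w s y‖ ≤ C) ∧
      (∀ (s : ℝ) (y : E₃), lerayOrbit w (s + 2 * Real.log lam) y = rotZ (-θ) (lerayOrbit w s (rotZ θ y))) := by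
  obtain ⟨q, hq⟩ := exists_isClassicalNSSolutionOn_Iio_of_isTypeIAncientMild hw
  refine ⟨lerayOrbitPressure q, isClassicalNSSolutionOn_Iio_iff_isBackwardLeraySolutionOn.1 hq, ?_, ?_⟩
  · intro s y
    have ht : -Real.exp (-s) < 0 := by have := Real.exp_pos (-s); linarith
    have hb := hw.norm_le ht (Real.exp (-s / 2) • y)
    rw [neg_neg, sqrt_exp_neg] at hb
    rw [lerayOrbit_apply, norm_smul, Real.norm_eq_abs, abs_of_pos (Real.exp_pos _)]
    calc Real.exp (-s / 2) * ‖w (-Real.exp (-s)) (Real.exp (-s / 2) • y)‖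
        ≤ Real.exp (-s / 2) * (C / Real.exp (-s / 2)) := mul_le_mul_of_nonneg_left hb (Real.exp_pos _).le
      _ = C := by field_simp
  · intro s y
    have h := IsRotatedDSS.lerayOrbit_add_period (isRotatedDSS_pastOf hl hs) hl s y
    rw [lerayOrbit_pastOf] at h
    rw [h, rotZLIE_symm_apply, rotZLIE_apply]

/-- **Centred version.**  A screw-scaling symmetry ABOUT A CENTRE `c` (`IsScrewAbout c θ λ v`) of `v ∈ A_C` gives the same normal form for the recentred
field `w = v(·, · + c)` (the class is translation invariant with the same constant, `IsTypeIAncientMild.comp_add_right`). -/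
theorem breather_normal_form_about {C θ lam : ℝ} {v : ℝ → E₃ → E₃} {c : E₃} (hv : IsTypeIAncientMild C v) (hl : 0 < lam)
    (hs : IsScrewAbout c θ lam v) :
    ∃ P : ℝ → E₃ → ℝ,
      IsBackwardLeraySolutionOn univ 1 (lerayOrbit fun t x => v t (x + c)) P ∧
      (∀ (s : ℝ) (y : E₃), ‖lerayOrbit (fun t x => v t (x + c)) s y‖ ≤ C) ∧
      (∀ (s : ℝ) (y : E₃), lerayOrbit (fun t x => v t (x + c)) (s + 2 * Real.log lam) y =
        rotZ (-θ) (lerayOrbit (fun t x => v t (x + c)) s (rotZ θ y))) :=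
  breather_normal_form (hv.comp_add_right c) hl hs

/-- **The period is positive exactly for expanding factors**: `λ > 1 ↔ S = 2 log λ > 0` — the SHRINKING-breather reading of H2 (a symmetry with `λ < 1`
is the inverse of one with `λ⁻¹ > 1`, `IsScrew.inv`). -/
theorem period_pos_iff {lam : ℝ} (hl : 0 < lam) : 0 < 2 * Real.log lam ↔ 1 < lam := by
  constructor
  · intro h
    by_contra hle
    have : Real.log lam ≤ 0 := Real.log_nonpos hl.le (not_lt.1 hle)
    linarith
  · intro h
    have := Real.log_pos h
    linarith

/-- **Poloidality is carried to the Leray frame** (`curl_lerayOrbit`): if every past slice of `w` has vorticity orthogonal to `e`, so does every slice of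
`V = lerayOrbit w`.  (With the pin normalisations evaluated at `s = 0`, `y = 0` — `V(0,0) = w(−1,0)` — H2 is a statement about bounded poloidal
twisted-periodic orbits of the Leray system.) -/
theorem lerayOrbit_poloidal {w : ℝ → E₃ → E₃} {e : E₃}
    (hpol : ∀ s < 0, ∀ y, inner ℝ (curl (w s) y) e = 0) (s : ℝ) (y : E₃) :
    inner ℝ (curl (lerayOrbit w s) y) e = 0 := by
  have ht : -Real.exp (-s) < 0 := by have := Real.exp_pos (-s); linarith
  rw [curl_lerayOrbit, inner_smul_left, hpol _ ht, mul_zero]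

/-- `V(0, 0) = w(−1, 0)`: the pin instant/point of the column is the origin of the Leray frame. -/
theorem lerayOrbit_zero_zero (w : ℝ → E₃ → E₃) : lerayOrbit w 0 0 = w (-1) 0 := by
  simp [lerayOrbit_apply]

end Summit.NavierStokesRegularity.NavierStokesRegularity.Cruxes.PoloidalWindowRigidity.CrystalBreather

end
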